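import Summits.CriticalPhenomena.CardyFormulaZ2.Theses.CardyPolygonWords
import Literature.Probability.RandomPlanarGeometry.KlebanZagierTheorem2
import Literature.Probability.RandomPlanarGeometry.RectangleModulusLambda
import HarnessLib

/-!
# Birth skeleton `Lines/birth.lean` for the crux `CardyPolygonWords.CardyRectangle`
(item `stmt-CriticalPhenomena-4782`, route `route-CriticalPhenomena-CardyPolygonWords`, sub-problem
`CardyFormulaZ2`; BC3 skeleton registered by the skeleton registrar `skel-stmt-CriticalPhenomena-4782`,
2026-08-17)

The crux (rank 2 of the route; "the unproved input of the whole transfer-matrix programme"):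
Cardy's formula, in G02's discretisation of bond percolation on `δℤ²` at `p = 1/2`
(`bondDomainCrossingProb R δ = discreteCrossingProb half R.carrier δ (R.arc 0) (R.arc 2)`), for EVERY
conformal rectangle `R` whose carrier is an open box `(0,a)×(0,b)` and whose four marked points are
the four corners — all eight corner markings (four starting corners, two orientations), so the crossing
is either between the two vertical or between the two horizontal closed sides:
`R.HasCrossingLimit (bondDomainCrossingProb R) cardyFunction`.

## The line: scaling function `P` of the aspect ratio ⟶ exact duality ⟶ conformal-block structure
## ⟶ Kleban–Zagier rigidity (Theorem 2, corrected — PROVED in the tree) ⟶ Cardy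

This is the mechanism the route itself names for this crux ("TL(β=1)/XXZ(Δ=−1/2) conformal towers +
boundary-state overlaps, conformal block, Kleban–Zagier rigidity + exact ℤ² duality
`P(r)+P(1/r)=1`"), cut so that the rigidity step is the tree's theorem
`Literature.Probability.RandomPlanarGeometry.KlebanZagier.theorem2_corrected` (Kleban–Zagier,
J. Stat. Phys. 113 (2003) §5 Thm 2, with the non-constancy hypothesis the printed statement lacks;
proved in `KlebanZagierTheorem2.lean`) rather than the unproved named fact `KlebanZagier.theorem1`
(which would need the EVEN-block selection rule). Write
`LR(a,b,δ) := discreteCrossingProb half (0,a)×(0,b) δ {re z = 0, 0 ≤ im z ≤ b} {re z = a, 0 ≤ im z ≤ b}`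
(left-to-right crossing of the G02-discretised box between its closed vertical sides).

* `stub_cornerArcsModulus` — GEOMETRY of corner-marked rectangles (provable now; size M–L): for such
  an `R`, the pair `(R.arc 0, R.arc 2)` is (left, right), (right, left), (bottom, top) or
  (top, bottom) — as closed sides — and every uniformizing datum `(φ, x)` has Cardy cross-ratio
  `crossRatio x = λ(i·a/b)` (`KlebanZagier.lamR (a/b)`) in the two vertical cases and `λ(i·b/a)` in
  the two horizontal ones. One marking (`pt = (ib, 0, a, a+ib)`) is the tree's
  `rectangle_crossRatio_eq_lamR` (`RectangleModulusLambda.lean`); the other seven follow by the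
  reflections / transposition of the box (anti-conformal symmetries: `crossRatio_neg`, `crossRatio_rev`,
  `ConformalRectangle.crossRatio_eq_of_isUniformizing_holds`) plus the Jordan-arc bookkeeping
  `arc i = boundary '' [mark i, nextMark i]` = the closed side between consecutive corners.
* `stub_transposeSymmetry` — LATTICE SYMMETRY (provable now; size M): at every mesh `δ` the
  bottom-to-top crossing probability of the G02-discretised box `(0,a)×(0,b)` equals `LR(b,a,δ)`:
  the transposition `(x₀,x₁) ↦ (x₁,x₀)` of `ℤ²` commutes with `meshVertices`, `meshGraph`, the
  largest-component rule `meshDomain` (a union over ALL maximal components, no tie-break), `discreteArc`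
  (closest-arc rule) and preserves `bondPercolation (zdGraph 2) half`.
* `stub_scalingLimit` — EXISTENCE of the scaling function (OPEN; the core; size XL): there is
  `P : ℝ → ℝ` with `LR(a,b,δ) → P(a/b)` as `δ → 0⁺` for all `a, b > 0` (dependence on `a/b` alone
  is automatic: `LR(λa,λb,λδ) = LR(a,b,δ)` exactly). RSW gives only subsequential limits in `(0,1)`
  (`discreteCrossingProb_clusterPt_mem_Ioo_holds`).
* `stub_duality` — EXACT ℤ² DUALITY in the limit (size M–L, provable from the hypothesis): any such
  `P` satisfies `P(1/r) = 1 − P(r)`: planar duality at `p = 1/2` (`lrCrossing_xor_dualTBCrossing`: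
  LR open crossing of the box xor TB closed crossing of the dual box), `stub_transposeSymmetry`, and
  insensitivity of the limit to the `O(δ)` change of box (monotonicity of crossing events in the box
  dimensions + continuity of `P`, itself from RSW quad-equicontinuity, Schramm–Smirnov 2011 §5).
* `stub_conformalBlock` — CONFORMAL-TOWER STRUCTURE (OPEN; size XL; the transfer-matrix heart): any
  such `P` is a Kleban–Zagier conformal block of some dimension `α > 0` with coefficients of polynomial
  growth: `P(r) = Σₙ aₙ e^{−π r (n+α)}` (`r > 0`), `a₀ ≠ 0`, `|aₙ| ≤ C (n+1)^k`. Lattice origin: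
  `Prob(LR of m×n) = Σ_k A_k(n) μ_k(n)^m` exactly (spectral decomposition of the stochastic
  Temperley–Lieb(β=1) row transfer matrix), scaled gaps `n·log(1/μ_k(n)) → π x_k` (XXZ at Δ = −1/2,
  integer-spaced boundary tower) with amplitude control uniform in the level. For Cardy's `Π_h` this
  holds with `α = 1/3` (`Π_h′ ∝ η(ir)⁴`, Kleban–Zagier §3).
* `stub_dimension` — THE BOUNDARY EXPONENT (OPEN; size L–XL): in any conformal-block representation of
  such a `P` with `α > 0`, `α = 1/3` — i.e. `−log P(r) ∼ π r/3` (Cardy's `π h_{1,3}`-decay of long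
  rectangles; the one-cluster Kac rate `n·γ₁(n) → π/3` of route CardyBoundaryCoulombGas'
  `StripClusterRates`, cf. `Theorems/CardyBoundaryCoulombGasStripClusterRatesOfCardyRectangle.lean`,
  which proves the converse direction `CardyRectangle → n·γ₁(n) → π/3`).

Composition `CardyRectangle_of` (REAL proof, no `sorry`): from `P` (stub 3), its block data (stub 5),
duality (stub 4) and `P(1) = 1/2`, `P → 0` at `∞` (`KlebanZagier.tendsto_P_atTop`, so `P` is not
constant), `KlebanZagier.theorem2_corrected` gives `P = genCardyFunction α ∘ modularLambdaI` on
`(0,∞)`; stub 6 pins `α = 1/3`, and `genCardyFunction (1/3) = cardyFunction` (Γ(4/3) = Γ(1/3)/3,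
proved below) with `modularLambdaI = lamR` gives `P(r) = F(λ(ir))`; finally stub 1 splits the eight
markings into the vertical cases (`bondDomainCrossingProb R δ = LR(a,b,δ)`, modulus `λ(ia/b)`) and the
horizontal ones (`= LR(b,a,δ)` by stub 2, modulus `λ(ib/a)`), the arc-swap symmetry
`discreteCrossingProb p Ω δ A B = discreteCrossingProb p Ω δ B A` being proved here.

Device (D-0027 §3.3, as in `Cruxes/CardyRigidity/Lines/birth.lean`): each stub is a sorried theorem
`Holds.stub_<name> : <full statement over tree declarations>` (registered under the short name
`stub_<name>` with that text) plus the by-name handle `def stub_<name> : Prop := type_of% Holds.stub_<name>`;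
the hypotheses of `CardyRectangle_of` are exactly the six handles, and `CardyRectangle_proof` applies it
to the six sorried stubs (which also certifies mechanically that the handles ARE the stub statements).
Sorries: exactly the six `Holds.stub_*`; nothing else.

Disproof used: none — no `Disproof.lean`, no `Negative/` lemma and no other workfile exists for this
crux at registration (`ledger crux ls stmt-CriticalPhenomena-4782`: "(no workfiles yet)", 2026-08-17);
the negatives index of the summit (11 refuted statements, 4 on this sub-problem: `not_SymmetryUpgrade`
stmt-0698, JunctionShadowing stmt-8581, degenerate arcs stmt-0748, DualCurrentTemplate stmt-6949) has no
statement about rectangle crossing limits, scaling functions or conformal blocks. No stub is a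
restatement: each of stubs 3–6 concerns ONE real function `P` of the aspect ratio, stubs 1–2 contain no
limit at all, and `stub → CardyRectangle` / `stub → CardyFormulaZ2` fail the cheap probes (BC3, see
`Lines/birth.md`).
-/

noncomputable section

namespace Summit.CriticalPhenomena.CardyFormulaZ2.Cruxes.CardyRectangle.Birth

open Set Filter Topology
open Literature.Probability.RandomPlanarGeometry
open Literature.Probability.RandomPlanarGeometry.KlebanZagier (IsConformalBlock lamR modularLambdaI
  genCardyFunction)
open Literature.Probability.Percolation (bondDomainCrossingProb discreteCrossingProb discreteCrossing half)
open Summit.CriticalPhenomena.CardyFormulaZ2.Theses.CardyPolygonWords (CardyRectangle)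

/-! ### The six registered stubs (the ONLY `sorry`s of this file) and their by-name handles -/

/-- **Stub 1 — geometry of corner-marked rectangles (arcs and modulus; provable now, M–L).** For a
conformal rectangle with carrier `(0,a)×(0,b)` and the four corners marked (any starting corner, either
orientation): arcs `0` and `2` are a pair of opposite CLOSED sides, and every uniformizing datum has
cross-ratio `λ(i·a/b)` when they are the vertical sides, `λ(i·b/a)` when they are the horizontal ones
(Kleban–Zagier 2003 §3 "the classical result for the cross-ratio"; `rectangle_crossRatio_eq_lamR`). -/
protected theorem Holds.stub_cornerArcsModulus : ∀ (R : Literature.Probability.RandomPlanarGeometry.ConformalRectangle) (a b : ℝ), 0 < a → 0 < b → R.carrier = {z : ℂ | 0 < z.re ∧ z.re < a ∧ 0 < z.im ∧ z.im < b} → Set.range R.pt = {(0 : ℂ), (a : ℂ), (a : ℂ) + (b : ℂ) * Complex.I, (b : ℂ) * Complex.I} → ∀ (φ : Literature.Probability.RandomPlanarGeometry.ConformalEquiv UpperHalfPlane.upperHalfPlaneSet R.carrier) (x : Fin 4 → ℝ), R.IsUniformizing φ x → (((R.arc 0 = {z : ℂ | z.re = 0 ∧ 0 ≤ z.im ∧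 z.im ≤ b} ∧ R.arc 2 = {z : ℂ | z.re = a ∧ 0 ≤ z.im ∧ z.im ≤ b}) ∨ (R.arc 0 = {z : ℂ | z.re = a ∧ 0 ≤ z.im ∧ z.im ≤ b} ∧ R.arc 2 = {z : ℂ | z.re = 0 ∧ 0 ≤ z.im ∧ z.im ≤ b})) ∧ Literature.Probability.RandomPlanarGeometry.crossRatio x = Literature.Probability.RandomPlanarGeometry.KlebanZagier.lamR (a / b)) ∨ (((R.arc 0 = {z : ℂ | z.im = 0 ∧ 0 ≤ z.re ∧ z.re ≤ a} ∧ R.arc 2 = {z : ℂ | z.im = b ∧ 0 ≤ z.re ∧ z.re ≤ a}) ∨ (R.arc 0 = {z : ℂ | z.im = b ∧ 0 ≤ z.re ∧ z.re ≤ a} ∧ R.arc 2 = {z : ℂ | z.im = 0 ∧ 0 ≤ z.re ∧ z.re ≤ a})) ∧ Literature.Probability.RandomPlanarGeometry.crossRatio x = Literature.Probability.RandomPlanarGeometry.KlebanZagier.lamR (b / a)) := by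
  sorry

/-- By-name handle of the registered stub `Holds.stub_cornerArcsModulus`. -/
def stub_cornerArcsModulus : Prop := type_of% Holds.stub_cornerArcsModulus

/-- **Stub 2 — transposition symmetry of the discretised crossing probability (provable now, M).**
At every mesh, the bottom-to-top crossing probability of the G02-discretised box `(0,a)×(0,b)` (closed
horizontal sides as arcs) equals the left-to-right crossing probability of the box `(0,b)×(0,a)`: the
transposition of `ℤ²` is an automorphism of every ingredient of `discreteCrossingProb` and of
`bondPercolation (zdGraph 2) half`. -/
protected theorem Holds.stub_transposeSymmetry : ∀ a b δ : ℝ, Literature.Probability.Percolation.discreteCrossingProb Literature.Probability.Percolation.half {z : ℂ | 0 < z.re ∧ z.re < a ∧ 0 < z.im ∧ z.im < b} δ {z : ℂ | z.im = 0 ∧ 0 ≤ z.re ∧ z.re ≤ a} {z : ℂ | z.im = b ∧ 0 ≤ z.re ∧ z.re ≤ a} = Literature.Probability.Percolation.discreteCrossingProb Literature.Probability.Percolation.half {z : ℂ | 0 < z.re ∧ z.re < b ∧ 0 < z.im ∧ z.im < a} δ {z : ℂ | z.re = 0 ∧ 0 ≤ z.im ∧ z.im ≤ a} {z : ℂ |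 z.re = b ∧ 0 ≤ z.im ∧ z.im ≤ a} := by
  sorry

/-- By-name handle of the registered stub `Holds.stub_transposeSymmetry`. -/
def stub_transposeSymmetry : Prop := type_of% Holds.stub_transposeSymmetry

/-- **Stub 3 — existence of the scaling function of the aspect ratio (OPEN; the core, XL).** There is
`P : ℝ → ℝ` such that for all `a, b > 0` the left-to-right crossing probability of the G02-discretised
box `(0,a)×(0,b)` (closed vertical sides as arcs) tends to `P (a/b)` as the mesh `δ → 0⁺`
(Cardy 1992; Langlands–Pouliot–Saint-Aubin 1994; open on `ℤ²`, Schramm ICM 2006 Problem 2.11). -/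
protected theorem Holds.stub_scalingLimit : ∃ P : ℝ → ℝ, ∀ a b : ℝ, 0 < a → 0 < b → Filter.Tendsto (fun δ : ℝ => Literature.Probability.Percolation.discreteCrossingProb Literature.Probability.Percolation.half {z : ℂ | 0 < z.re ∧ z.re < a ∧ 0 < z.im ∧ z.im < b} δ {z : ℂ | z.re = 0 ∧ 0 ≤ z.im ∧ z.im ≤ b} {z : ℂ | z.re = a ∧ 0 ≤ z.im ∧ z.im ≤ b}) (nhdsWithin 0 (Set.Ioi 0)) (nhds (P (a / b))) := by
  sorry

/-- By-name handle of the registered stub `Holds.stub_scalingLimit`. -/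
def stub_scalingLimit : Prop := type_of% Holds.stub_scalingLimit

/-- **Stub 4 — exact `ℤ²` duality of the scaling function (M–L, provable from the hypothesis).** Any
scaling function `P` of stub 3 satisfies `P (1/r) = 1 − P r` for `r > 0` (planar duality at the
self-dual point `p = 1/2`, Grimmett 1999 §11.2; transposition, stub 2; `O(δ)` insensitivity of the limit
by monotonicity in the box dimensions and RSW quad-continuity, Schramm–Smirnov 2011 §5). -/
protected theorem Holds.stub_duality : ∀ P : ℝ → ℝ, (∀ a b : ℝ, 0 < a → 0 < b → Filter.Tendsto (fun δ : ℝ => Literature.Probability.Percolation.discreteCrossingProb Literature.Probability.Percolation.half {z : ℂ | 0 < z.re ∧ z.re < a ∧ 0 < z.im ∧ z.im < b} δ {z : ℂ | z.re = 0 ∧ 0 ≤ z.im ∧ z.im ≤ b} {z : ℂ | z.re = a ∧ 0 ≤ z.im ∧ z.im ≤ b}) (nhdsWithin 0 (Set.Ioi 0)) (nhds (P (a / b)))) → ∀ r : ℝ, 0 < r → P (1 / r) = 1 - P r := by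
  sorry

/-- By-name handle of the registered stub `Holds.stub_duality`. -/
def stub_duality : Prop := type_of% Holds.stub_duality

/-- **Stub 5 — conformal-block structure of the scaling function (OPEN; XL; the transfer-matrix
heart).** Any scaling function `P` of stub 3 is a Kleban–Zagier conformal block of some dimension
`α > 0` with coefficients of polynomial growth: `P(r) = Σₙ aₙ e^{−π r (n+α)}` for `r > 0`, `a₀ ≠ 0`,
`|aₙ| ≤ C (n+1)^k` (Kleban–Zagier 2003 §5, hypotheses (i′) of Theorem 2; lattice side: spectral
decomposition of the stochastic Temperley–Lieb(β=1) transfer matrix of the strip and the XXZ(Δ=−1/2)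
boundary conformal towers, with amplitude control uniform in the level). -/
protected theorem Holds.stub_conformalBlock : ∀ P : ℝ → ℝ, (∀ a b : ℝ, 0 < a → 0 < b → Filter.Tendsto (fun δ : ℝ => Literature.Probability.Percolation.discreteCrossingProb Literature.Probability.Percolation.half {z : ℂ | 0 < z.re ∧ z.re < a ∧ 0 < z.im ∧ z.im < b} δ {z : ℂ | z.re = 0 ∧ 0 ≤ z.im ∧ z.im ≤ b} {z : ℂ | z.re = a ∧ 0 ≤ z.im ∧ z.im ≤ b}) (nhdsWithin 0 (Set.Ioi 0)) (nhds (P (a / b)))) → ∃ (α : ℝ) (c : ℕ → ℝ), 0 < α ∧ Literature.Probability.RandomPlanarGeometry.KlebanZagier.IsConformalBlock P α c ∧ ∃ C k : ℝ, ∀ n : ℕ, |c n| ≤ C * ((n : ℝ) + 1) ^ k := by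
  sorry

/-- By-name handle of the registered stub `Holds.stub_conformalBlock`. -/
def stub_conformalBlock : Prop := type_of% Holds.stub_conformalBlock

/-- **Stub 6 — the boundary exponent: the block dimension is `1/3` (OPEN; L–XL).** In any
conformal-block representation with `α > 0` of a scaling function `P` of stub 3, `α = 1/3`, i.e.
`−log P(r) ∼ π r / 3` as `r → ∞` (Cardy 1992: `Π_h(r) ≍ e^{−π r/3}`; the `π h_{1,3}` Kac rate). The
dimension is intrinsic (leading exponential rate), so no growth hypothesis is needed. -/
protected theorem Holds.stub_dimension : ∀ P : ℝ → ℝ, (∀ a b : ℝ, 0 < a → 0 < b → Filter.Tendsto (fun δ : ℝ => Literature.Probability.Percolation.discreteCrossingProb Literature.Probability.Percolation.half {z : ℂ | 0 < z.re ∧ z.re < a ∧ 0 < z.im ∧ z.im < b} δ {z : ℂ | z.re = 0 ∧ 0 ≤ z.im ∧ z.im ≤ b} {z : ℂ | z.re = a ∧ 0 ≤ z.im ∧ z.im ≤ b}) (nhdsWithin 0 (Set.Ioi 0)) (nhds (P (a / b)))) → ∀ (α : ℝ) (c : ℕ → ℝ), 0 < α → Literature.Probability.RandomPlanarGeometry.KlebanZagier.IsConformalBlock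 P α c → α = 1 / 3 := by
  sorry

/-- By-name handle of the registered stub `Holds.stub_dimension`. -/
def stub_dimension : Prop := type_of% Holds.stub_dimension

/-! ### Sorry-free glue lemmas used by the composition -/

/-- The crossing event, hence the crossing probability, is symmetric in the two arcs (paths reverse). -/
theorem discreteCrossingProb_comm (p : unitInterval) (Ω : Set ℂ) (δ : ℝ) (A B : Set ℂ) :
    discreteCrossingProb p Ω δ A B = discreteCrossingProb p Ω δ B A := by
  have h : discreteCrossing Ω δ A B = discreteCrossing Ω δ B A := by
    ext ω
    simp only [Literature.Probability.Percolation.mem_discreteCrossing_iff]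
    constructor
    · rintro ⟨x, hx, y, hy, hxy⟩
      exact ⟨y, hy, x, hx, hxy.symm⟩
    · rintro ⟨x, hx, y, hy, hxy⟩
      exact ⟨y, hy, x, hx, hxy.symm⟩
  unfold Literature.Probability.Percolation.discreteCrossingProb
  rw [h]

/-- `genCardyFunction (1/3) = cardyFunction`: the SLE₆ member of Kleban–Zagier's family `Π_h(·;α)` is
Cardy's function (`Γ(4/3) = Γ(1/3)/3`, so `Γ(2/3)/(Γ(1/3)Γ(4/3)) = 3Γ(2/3)/Γ(1/3)²`). -/
theorem genCardyFunction_one_third (η : ℝ) : genCardyFunction (1 / 3) η = cardyFunction η := by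
  have hΓ : Real.Gamma (1 + 1 / 3 : ℝ) = 1 / 3 * Real.Gamma (1 / 3) := by
    rw [add_comm]
    exact Real.Gamma_add_one (by norm_num)
  have hΓ0 : Real.Gamma (1 / 3 : ℝ) ≠ 0 := (Real.Gamma_pos_of_pos (by norm_num)).ne'
  rw [Literature.Probability.RandomPlanarGeometry.KlebanZagier.genCardyFunction,
    Literature.Probability.RandomPlanarGeometry.cardyFunction, hΓ]
  have e1 : (2 : ℝ) * (1 / 3) = 2 / 3 := by norm_num
  have e2 : (1 : ℝ) - 1 / 3 = 2 / 3 := by norm_num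
  have e3 : (1 : ℝ) + 1 / 3 = 4 / 3 := by norm_num
  have e4 : Real.Gamma (2 / 3) / (Real.Gamma (1 / 3) * (1 / 3 * Real.Gamma (1 / 3))) =
      3 * Real.Gamma (2 / 3) / Real.Gamma (1 / 3) ^ 2 := by
    field_simp
  rw [e1, e2, e3, e4]

/-! ### Composition (sorry-free): the six stubs imply the crux BY NAME -/

/-- **`CardyRectangle` from the six stubs (real proof).** See the module docstring. -/
theorem CardyRectangle_of (hG : stub_cornerArcsModulus) (hT : stub_transposeSymmetry)
    (hE : stub_scalingLimit) (hD : stub_duality) (hB : stub_conformalBlock) (hα : stub_dimension) :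
    CardyRectangle := by
  dsimp only [stub_cornerArcsModulus, stub_transposeSymmetry, stub_scalingLimit, stub_duality,
    stub_conformalBlock, stub_dimension] at hG hT hE hD hB hα
  -- the scaling function and its structure
  obtain ⟨P, hP⟩ := hE
  obtain ⟨α, c, hαpos, hblock, hgr⟩ := hB P hP
  have hdual : ∀ r : ℝ, 0 < r → P (1 / r) = 1 - P r := hD P hP
  have hthird : α = 1 / 3 := hα P hP α c hαpos hblock
  -- `P 1 = 1/2` (duality) and `P → 0` at `∞` (block of positive dimension): `P` is not constant
  have hone : P 1 = 1 / 2 := by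
    have h := hdual 1 one_pos
    rw [div_one] at h
    linarith
  obtain ⟨C, m, hC, hcm⟩ := Literature.Probability.RandomPlanarGeometry.KlebanZagier.polyGrowth_nat hgr
  have hlim : Tendsto P atTop (𝓝 0) :=
    Literature.Probability.RandomPlanarGeometry.KlebanZagier.tendsto_P_atTop hblock hcm hC hαpos
  have hnc : ∃ r s : ℝ, 0 < r ∧ 0 < s ∧ P r ≠ P s := by
    have hev : ∀ᶠ t in atTop, dist (P t) 0 < 1 / 4 :=
      (Metric.tendsto_nhds.1 hlim) (1 / 4) (by norm_num)
    obtain ⟨t, ht1, ht⟩ := ((eventually_ge_atTop (1 : ℝ)).and hev).exists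
    refine ⟨t, 1, by linarith, one_pos, ?_⟩
    rw [hone]
    intro h
    rw [h, Real.dist_eq] at ht
    norm_num at ht
  -- Kleban–Zagier, Theorem 2 (corrected; proved in the tree): `P = Π_h(·;α) ∘ λ(i·)` on `(0,∞)`
  obtain ⟨-, -, hKZ⟩ :=
    Literature.Probability.RandomPlanarGeometry.KlebanZagier.theorem2_corrected P α c hblock hgr hdual hnc
  have hcardy : ∀ r : ℝ, 0 < r → P r = cardyFunction (lamR r) := by
    intro r hr
    rw [hKZ r hr, hthird, genCardyFunction_one_third,
      Literature.Probability.RandomPlanarGeometry.KlebanZagier.modularLambdaI_eq_lamR hr]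
  -- the crux, marking by marking
  intro R a b ha hb hcar hpt φ x hφx
  rcases hG R a b ha hb hcar hpt φ x hφx with ⟨harcs, hcr⟩ | ⟨harcs, hcr⟩
  · -- arcs 0 / 2 are the vertical sides: the crossing probability IS `LR(a,b,·)`, modulus `λ(ia/b)`
    rw [hcr, ← hcardy (a / b) (div_pos ha hb)]
    refine (hP a b ha hb).congr fun δ => ?_
    symm
    rcases harcs with ⟨h0, h2⟩ | ⟨h0, h2⟩
    · show discreteCrossingProb half R.carrier δ (R.arc 0) (R.arc 2) = _
      rw [hcar, h0, h2]
    · have e : bondDomainCrossingProb R δ = discreteCrossingProb half R.carrier δ (R.arc 2) (R.arc 0) :=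
        discreteCrossingProb_comm _ _ _ _ _
      rw [e, hcar, h0, h2]
  · -- arcs 0 / 2 are the horizontal sides: transpose to `LR(b,a,·)` (stub 2), modulus `λ(ib/a)`
    rw [hcr, ← hcardy (b / a) (div_pos hb ha)]
    refine (hP b a hb ha).congr fun δ => ?_
    symm
    rcases harcs with ⟨h0, h2⟩ | ⟨h0, h2⟩
    · show discreteCrossingProb half R.carrier δ (R.arc 0) (R.arc 2) = _
      rw [hcar, h0, h2]
      exact hT a b δ
    · have e : bondDomainCrossingProb R δ = discreteCrossingProb half R.carrier δ (R.arc 2) (R.arc 0) :=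
        discreteCrossingProb_comm _ _ _ _ _
      rw [e, hcar, h0, h2]
      exact hT a b δ

/-- **The crux BY NAME from the six stubs** (depends on `sorryAx` ONLY through the six `Holds.stub_*`;
this line also certifies that the by-name handles ARE the stub statements). -/
theorem CardyRectangle_proof : CardyRectangle :=
  CardyRectangle_of Holds.stub_cornerArcsModulus Holds.stub_transposeSymmetry Holds.stub_scalingLimit
    Holds.stub_duality Holds.stub_conformalBlock Holds.stub_dimension

end Summit.CriticalPhenomena.CardyFormulaZ2.Cruxes.CardyRectangle.Birth

end
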